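import Literature.NumberTheory.GaloisRepresentations.DualNumberLiftConditions
import Literature.NumberTheory.GaloisRepresentations.OrdinaryPolarizedDeformationRingProofs
import HarnessLib

/-!
# The tangent space of the nearly ordinary deformation functor is a Selmer group
# (Böckle Thm. 2.2 (a) with Ex. 7.1 / Lemma 7.4; Mazur §21–§23)

Topic `Literature/NumberTheory/GaloisRepresentations`.  For a nearly ordinary residual datum `𝒟`
(`NearlyOrdinaryDeformationRing.lean`) we identify the deformations of type `𝒟` to the dual
numbers `k[ε]` with **Selmer cocycles**: continuous `ad ρ̄`-valued 1-cocycles `c` on `Γ_F`,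
vanishing on the inertia groups outside `S`, and at each `v ∣ p` cohomologous on `Γ_{F_v}` (in
the residual frame) to a cocycle with values in the Borel `𝔟_v` of the special line — Böckle's
subspace `L_v ⊂ H¹(G_v, ad)` for the `P_v`-nearly ordinary functor ([Böc07, Ex. 7.1,
Lemma 7.4], [Maz97, §21 "`t ≅ H¹`", §23]).  Everything is PROVED:

* `NearlyOrdinaryDatum.IsSelmerCocycle` — the three conditions on an `ad ρ̄`-cocycle;
* `NearlyOrdinaryDatum.isDeformation_dualNumber_iff` — a homomorphism
  `ρ : Γ_F → GL₂(k[ε])` is a deformation of type `𝒟` (for the augmentation `fst`) iff it reduces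
  to `ρ̄` and its cocycle (`DualNumberLifts.lean`) is a Selmer cocycle;
* `NearlyOrdinaryDatum.isStrictEquiv_dualNumber_iff` — two such deformations are strictly
  equivalent iff their cocycles are cohomologous;
* `NearlyOrdinaryDeformationRing.isDeformation_map_dualNumber` — for a universal ring `𝓡` and an
  `𝒪`-algebra map `φ : R_𝒟 → k[ε]`, `φ ∘ ρ_𝒟` is a deformation of type `𝒟` to `k[ε]`;
* `NearlyOrdinaryDeformationRing.tangentSpaceEquivSelmer` — **`t_{R_𝒟} = Hom_𝒪(R_𝒟, k[ε]) ≃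
  H¹_𝒟 :=` Selmer cocycles modulo coboundaries** (universality of `𝓡` at `k[ε]`), and
  `NearlyOrdinaryDeformationRing.natCard_selmerGroup`: `#H¹_𝒟 = #Hom_𝒪(R_𝒟, k[ε])` (which is
  `#k ^ h`, `h` the number of variables of the cotangent presentation of `R_𝒟`, by
  `NearlyOrdinaryPresentationProofs.lean`: Böckle's `ℓ̃ = dim_k t_{R̃} = h¹_L`).

## References

* G. Böckle, *Presentations of universal deformation rings*, LMS LNS 320 (2007), Thm. 2.2 (a),
  Ex. 7.1, Lemma 7.2, Lemma 7.4. [cite: Bockle2007Presentations, Lemma 7.4]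
* B. Mazur, *An introduction to the deformation theory of Galois representations* (1997), §21,
  §23. [cite: Mazur1997Deformation, §21]
-/

noncomputable section

namespace Literature.NumberTheory.GaloisRepresentations

open Matrix TrivSqZeroExt DualNumber Deformation IsLocalRing
open scoped NumberField
open Field IsDedekindDomain

/-! ## The dual numbers as a coefficient ring: `fst` as augmentation -/

section DualNumberCoeff

variable {𝒪 : Type} [CommRing 𝒪] {k : Type} [Field k] [Algebra 𝒪 k]

/-- The augmentation `fst : k[ε] →ₐ[𝒪] k`, as a ring homomorphism, is `fstHom k k k`.
[folklore] -/
theorem fstHom_toRingHom_eq :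
    ((TrivSqZeroExt.fstHom 𝒪 k k : k[ε] →ₐ[𝒪] k) : k[ε] →+* k) =
      (TrivSqZeroExt.fstHom k k k : k[ε] →+* k) :=
  RingHom.ext fun _ => rfl

/-- `𝔪_{k[ε]}² = 0`. [folklore] -/
theorem maximalIdeal_dualNumber_sq : maximalIdeal (k[ε]) ^ 2 = ⊥ := by
  rw [DualNumber.maximalIdeal_eq_span_singleton_eps, Ideal.span_singleton_pow,
    Ideal.span_singleton_eq_bot, pow_two, DualNumber.eps_mul_eps]

variable {Γ : Type*} [Group Γ] [TopologicalSpace Γ] {n : ℕ}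

/-- **A homomorphism to `GL_n(k[ε])` is `𝔪`-adically continuous iff its kernel is open**
(`𝔪² = 0`, so all the reductions modulo `𝔪^m`, `m ≥ 2`, are injective). [cite: Mazur1997Deformation, §21] -/
theorem isAdicContinuous_dualNumber_iff [ContinuousMul Γ] (ρ : Γ →* GL (Fin n) (k[ε])) :
    IsAdicContinuous ρ ↔ IsOpen (ρ.ker : Set Γ) := by
  constructor
  · intro h
    have h2 := h 2
    have hinj : Function.Injective (Ideal.Quotient.mk (maximalIdeal (k[ε]) ^ 2)) := by
      rw [RingHom.injective_iff_ker_eq_bot, Ideal.mk_ker, maximalIdeal_dualNumber_sq]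
    have hker : ((Matrix.GeneralLinearGroup.map (Ideal.Quotient.mk (maximalIdeal (k[ε]) ^ 2))).comp
        ρ).ker = ρ.ker := by
      ext γ
      simp only [MonoidHom.mem_ker, MonoidHom.comp_apply]
      constructor
      · intro hγ
        exact generalLinearGroup_map_injective _ hinj (by rw [hγ, map_one])
      · intro hγ
        rw [hγ, map_one]
    rwa [hker] at h2
  · intro h m
    refine Subgroup.isOpen_mono ?_ h
    intro γ hγ
    rw [MonoidHom.mem_ker] at hγ ⊢
    rw [MonoidHom.comp_apply, hγ, map_one]

end DualNumberCoeff

/-! ## Selmer cocycles and deformations to `k[ε]` -/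

namespace NearlyOrdinaryDatum

variable {F : Type} [Field F] [NumberField F] {p : ℕ} {𝒪 : Type} [CommRing 𝒪] {k : Type}
  [Field k] [Algebra 𝒪 k] (𝒟 : NearlyOrdinaryDatum F p 𝒪 k)

/-- **Selmer cocycles** for the datum `𝒟`: an `ad ρ̄`-valued 1-cocycle `c` on `Γ_F` which is
(i) continuous (locally constant: `M₂(k)` is discrete), (ii) unramified outside `S` (`c` vanishes
on every inertia group above `v ∉ S`), and (iii) nearly ordinary at each `v ∣ p`: for some
`Y ∈ M₂(k)`, in the residual frame `f = frame v` the cocycle `f⁻¹ c f + ∂Y` restricted to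
`Γ_{F_v}` takes upper-triangular values (its class lies in the image of `H¹(G_v, 𝔟_v)`,
Böckle's `L_v` for the `P_v`-nearly ordinary functor).
[cite: Bockle2007Presentations, Lemma 7.4] [cite: Mazur1997Deformation, §23] -/
structure IsSelmerCocycle (c : AdCocycle 𝒟.residual) : Prop where
  /-- `c` is continuous for the discrete topology. -/
  isLocallyConstant : IsLocallyConstant c.1
  /-- `c` vanishes on the inertia groups above the places outside `S`. -/
  unramified : ∀ v ∉ 𝒟.S, ∀ 𝔓 ∈ v.primesAbove, ∀ σ ∈ 𝔓.inertia (absoluteGaloisGroup F), c.1 σ = 0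
  /-- At `v ∣ p`, `c|_{Γ_{F_v}}` is cohomologous in the frame `frame v` to a `𝔟`-valued cocycle. -/
  nearlyOrdinary : ∀ v : HeightOneSpectrum (𝓞 F), (p : 𝓞 F) ∈ v.asIdeal →
    ∃ Y : Matrix (Fin 2) (Fin 2) k, ∀ σ : absoluteGaloisGroup (v.adicCompletion F),
      ((𝒟.frame v)⁻¹.val * c.1 (absGaloisRestrict F (v.adicCompletion F) σ) * (𝒟.frame v).val +
          ((𝒟.frame v)⁻¹ * 𝒟.residual (absGaloisRestrict F (v.adicCompletion F) σ) *
              𝒟.frame v).val * Y *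
            ((𝒟.frame v)⁻¹ * 𝒟.residual (absGaloisRestrict F (v.adicCompletion F) σ) *
              𝒟.frame v)⁻¹.val - Y) 1 0 = 0

/-- The reduction condition `GL₂(fst) ∘ ρ = ρ̄`, entrywise. [folklore] -/
theorem map_fstHom_comp_eq_iff (ρ : absoluteGaloisGroup F →* GL (Fin 2) (k[ε])) :
    (Matrix.GeneralLinearGroup.map
        ((TrivSqZeroExt.fstHom 𝒪 k k : k[ε] →ₐ[𝒪] k) : k[ε] →+* k)).comp ρ = 𝒟.residual ↔
      ∀ g, (ρ g).val.map fst = (𝒟.residual g).val := by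
  rw [MonoidHom.ext_iff]
  refine forall_congr' fun g => ?_
  rw [MonoidHom.comp_apply, ← Units.val_inj]
  exact Iff.rfl

/-- **Deformations of type `𝒟` to `k[ε]` are exactly the lifts `(1 + εc)ρ̄` by Selmer
cocycles `c`** (continuity ⟺ `c` locally constant, `DualLift.isOpen_ker_iff_continuous`;
unramified outside `S` ⟺ `c` vanishes on inertia, `DualLift.forall_apply_eq_one_iff`; nearly
ordinary at `v ∣ p` ⟺ the `L_v`-condition, `DualLift.exists_noFrame_iff`).
[cite: Bockle2007Presentations, Lemma 7.4] [cite: Mazur1997Deformation, §21] -/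
theorem isDeformation_dualNumber_iff (ρ : absoluteGaloisGroup F →* GL (Fin 2) (k[ε])) :
    𝒟.IsDeformation (TrivSqZeroExt.fstHom 𝒪 k k) ρ ↔
      ∃ h : ∀ g, (ρ g).val.map fst = (𝒟.residual g).val,
        𝒟.IsSelmerCocycle (DualLift.cocycle (ρbar := 𝒟.residual) ⟨ρ, h⟩) := by
  letI : TopologicalSpace (Matrix (Fin 2) (Fin 2) k) := ⊥
  haveI : DiscreteTopology (Matrix (Fin 2) (Fin 2) k) := ⟨rfl⟩
  constructor
  · intro hρ
    have h : ∀ g, (ρ g).val.map fst = (𝒟.residual g).val :=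
      (𝒟.map_fstHom_comp_eq_iff ρ).mp hρ.residual_eq
    refine ⟨h, ⟨?_, fun v hv 𝔓 h𝔓 σ hσ => ?_, fun v hv => ?_⟩⟩
    · rw [IsLocallyConstant.iff_continuous]
      exact (DualLift.isOpen_ker_iff_continuous (ρbar := 𝒟.residual) ⟨ρ, h⟩ 𝒟.isOpen_ker_residual).mp
        ((isAdicContinuous_dualNumber_iff ρ).mp hρ.isAdicContinuous)
    · exact ((DualLift.forall_apply_eq_one_iff (ρbar := 𝒟.residual) ⟨ρ, h⟩
        {σ | σ ∈ 𝔓.inertia (absoluteGaloisGroup F)}).mp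
        (fun τ hτ => hρ.unramified v hv 𝔓 h𝔓 τ hτ)).2 σ hσ
    · obtain ⟨P, hP1, hP2⟩ := hρ.isNearlyOrdinaryAt v hv
      refine (DualLift.exists_noFrame_iff (ρbar := 𝒟.residual) ⟨ρ, h⟩
        (fun σ => absGaloisRestrict F (v.adicCompletion F) σ) (𝒟.frame v)
        (𝒟.frame_spec v hv)).mp ⟨P, ?_, hP2⟩
      rw [Units.val_mul] at hP1
      exact hP1
  · rintro ⟨h, hc⟩
    refine ⟨⟨?_, (𝒟.map_fstHom_comp_eq_iff ρ).mpr h, fun v hv 𝔓 h𝔓 σ hσ => ?_⟩, fun v hv => ?_⟩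
    · rw [isAdicContinuous_dualNumber_iff]
      exact (DualLift.isOpen_ker_iff_continuous (ρbar := 𝒟.residual) ⟨ρ, h⟩ 𝒟.isOpen_ker_residual).mpr
        ((IsLocallyConstant.iff_continuous _).mp hc.isLocallyConstant)
    · exact (DualLift.forall_apply_eq_one_iff (ρbar := 𝒟.residual) ⟨ρ, h⟩
        {σ | σ ∈ 𝔓.inertia (absoluteGaloisGroup F)}).mpr
        ⟨fun τ hτ => 𝒟.residual_unramified v hv 𝔓 h𝔓 τ hτ, fun τ hτ => hc.unramified v hv 𝔓 h𝔓 τ hτ⟩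
        σ hσ
    · obtain ⟨P, hP1, hP2⟩ := (DualLift.exists_noFrame_iff (ρbar := 𝒟.residual) ⟨ρ, h⟩
        (fun σ => absGaloisRestrict F (v.adicCompletion F) σ) (𝒟.frame v)
        (𝒟.frame_spec v hv)).mpr (hc.nearlyOrdinary v hv)
      refine ⟨P, ?_, hP2⟩
      rw [Units.val_mul]
      exact hP1

/-- **Strict equivalence of deformations to `k[ε]` ⟺ cohomologous cocycles.**
[cite: Mazur1997Deformation, §21] -/
theorem isStrictEquiv_dualNumber_iff (ρ₁ ρ₂ : DualLift 𝒟.residual) :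
    IsStrictEquiv ((TrivSqZeroExt.fstHom 𝒪 k k : k[ε] →ₐ[𝒪] k) : k[ε] →+* k) ρ₁.1 ρ₂.1 ↔
      ∃ X : Matrix (Fin 2) (Fin 2) k, ∀ g,
        (ρ₂.cocycle).1 g = (ρ₁.cocycle).1 g + X - (𝒟.residual g).val * X * (𝒟.residual g)⁻¹.val := by
  rw [fstHom_toRingHom_eq]
  exact DualLift.isStrictEquiv_iff ρ₁ ρ₂

/-- The **cohomology relation** on Selmer cocycles: `c ∼ c'` iff `c' = c + ∂X`. [folklore] -/
def selmerSetoid : Setoid {c : AdCocycle 𝒟.residual // 𝒟.IsSelmerCocycle c} where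
  r c c' := ∃ X : Matrix (Fin 2) (Fin 2) k, ∀ g,
    c'.1.1 g = c.1.1 g + X - (𝒟.residual g).val * X * (𝒟.residual g)⁻¹.val
  iseqv :=
    { refl := fun c => ⟨0, fun g => by simp⟩
      symm := fun {c c'} ⟨X, hX⟩ => ⟨-X, fun g => by
        rw [hX g, Matrix.mul_neg, Matrix.neg_mul]
        abel⟩
      trans := fun {c c' c''} ⟨X, hX⟩ ⟨X', hX'⟩ => ⟨X + X', fun g => by
        rw [hX' g, hX g, Matrix.mul_add, Matrix.add_mul]
        abel⟩ }

/-- **The Selmer group `H¹_𝒟`** of the datum (as a set): Selmer cocycles modulo coboundaries —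
the tangent space of the nearly ordinary deformation functor. [cite: Bockle2007Presentations, Lemma 7.4] -/
def SelmerGroup : Type := Quotient 𝒟.selmerSetoid

end NearlyOrdinaryDatum

/-! ## The tangent space of `R_𝒟` is the Selmer group -/

namespace NearlyOrdinaryDeformationRing

variable {F : Type} [Field F] [NumberField F] {p : ℕ} {𝒪 : Type} [CommRing 𝒪] {k : Type}
  [Field k] [Algebra 𝒪 k] [Finite k] {𝒟 : NearlyOrdinaryDatum F p 𝒪 k}
  (𝓡 : NearlyOrdinaryDeformationRing.{0} 𝒟)

/-- `R_𝒟` as an object of Mazur's category `Ĉ_𝒪(k)`. [cite: Mazur1997Deformation, §2] -/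
def toCNL : CNLAlgebra 𝒪 k :=
  { carrier := 𝓡.R
    residue := 𝓡.π
    residue_surjective := 𝓡.π_surjective }

/-- **Push-forward of the universal deformation to `k[ε]`**: for an `𝒪`-algebra map
`φ : R_𝒟 → k[ε]`, `φ ∘ ρ_𝒟` is a deformation of type `𝒟` to `(k[ε], fst)` (morphisms of
`Ĉ_𝒪(k)` are local and compatible with augmentations; frames push forward).
[cite: Mazur1997Deformation, §8 and §20 Prop. 2] -/
theorem isDeformation_map_dualNumber (φ : 𝓡.R →ₐ[𝒪] k[ε]) :
    𝒟.IsDeformation (TrivSqZeroExt.fstHom 𝒪 k k)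
      ((Matrix.GeneralLinearGroup.map (φ : 𝓡.R →+* k[ε])).comp 𝓡.ρ) := by
  have hk := 𝒟.residueMap_surjective
  have hπ : ((TrivSqZeroExt.fstHom 𝒪 k k : k[ε] →ₐ[𝒪] k) : k[ε] →+* k).comp (φ : 𝓡.R →+* k[ε]) =
      (𝓡.π : 𝓡.R →+* k) :=
    RingHom.ext fun x => DFunLike.congr_fun (𝓡.augmentation_comp (TrivSqZeroExt.fstHom 𝒪 k k) φ) x
  refine ⟨⟨?_, ?_, fun v hv 𝔓 h𝔓 σ hσ => ?_⟩, fun v hv => ?_⟩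
  · exact IsAdicContinuous.comp_map hk (A := 𝓡.toCNL) (B := dualCNL 𝒪 k) φ
      𝓡.isLift.isAdicContinuous
  · rw [← MonoidHom.comp_assoc, ← Matrix.GeneralLinearGroup.map_comp, hπ]
    exact 𝓡.isLift.residual_eq
  · rw [MonoidHom.comp_apply, 𝓡.isLift.unramified v hv 𝔓 h𝔓 σ hσ, map_one]
  · refine ⟨Matrix.GeneralLinearGroup.map (φ : 𝓡.R →+* k[ε]) (𝓡.noFrame v), ?_, fun σ => ?_⟩
    · rw [← Matrix.GeneralLinearGroup.map_comp_apply, ← Matrix.GeneralLinearGroup.map_comp, hπ]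
      exact 𝓡.noFrame_residual v hv
    · have h := 𝓡.noFrame_upper v hv σ
      have hmap : (Matrix.GeneralLinearGroup.map (φ : 𝓡.R →+* k[ε]) (𝓡.noFrame v))⁻¹ *
          ((Matrix.GeneralLinearGroup.map (φ : 𝓡.R →+* k[ε])).comp 𝓡.ρ)
            (absGaloisRestrict F (v.adicCompletion F) σ) *
          Matrix.GeneralLinearGroup.map (φ : 𝓡.R →+* k[ε]) (𝓡.noFrame v) =
          Matrix.GeneralLinearGroup.map (φ : 𝓡.R →+* k[ε])
            ((𝓡.noFrame v)⁻¹ * 𝓡.ρ (absGaloisRestrict F (v.adicCompletion F) σ) * 𝓡.noFrame v) := by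
        simp [map_mul, map_inv]
      rw [hmap]
      change φ (((𝓡.noFrame v)⁻¹ * 𝓡.ρ (absGaloisRestrict F (v.adicCompletion F) σ) *
        𝓡.noFrame v).val 1 0) = 0
      rw [h, map_zero]

/-- Every `𝒪`-algebra map `R_𝒟 → k[ε]` reduces `ρ_𝒟` to `ρ̄`. [folklore] -/
theorem map_fst_comp_apply (φ : 𝓡.R →ₐ[𝒪] k[ε]) (g : absoluteGaloisGroup F) :
    (((Matrix.GeneralLinearGroup.map (φ : 𝓡.R →+* k[ε])).comp 𝓡.ρ) g).val.map fst =
      (𝒟.residual g).val :=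
  (𝒟.map_fstHom_comp_eq_iff _).mp (𝓡.isDeformation_map_dualNumber φ).residual_eq g

/-- The Selmer cocycle of `φ : R_𝒟 → k[ε]` (the cocycle of the deformation `φ ∘ ρ_𝒟`).
[cite: Bockle2007Presentations, Lemma 7.4] -/
def selmerCocycle (φ : 𝓡.R →ₐ[𝒪] k[ε]) : {c : AdCocycle 𝒟.residual // 𝒟.IsSelmerCocycle c} :=
  ⟨DualLift.cocycle (ρbar := 𝒟.residual)
      ⟨(Matrix.GeneralLinearGroup.map (φ : 𝓡.R →+* k[ε])).comp 𝓡.ρ, 𝓡.map_fst_comp_apply φ⟩, by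
    obtain ⟨h, hc⟩ := (𝒟.isDeformation_dualNumber_iff _).mp (𝓡.isDeformation_map_dualNumber φ)
    exact hc⟩

/-- The class in `H¹_𝒟` of `φ : R_𝒟 → k[ε]`. [cite: Bockle2007Presentations, Lemma 7.4] -/
def selmerClass (φ : 𝓡.R →ₐ[𝒪] k[ε]) : 𝒟.SelmerGroup :=
  Quotient.mk 𝒟.selmerSetoid (𝓡.selmerCocycle φ)

/-- **`t_{R_𝒟} = Hom_𝒪(R_𝒟, k[ε]) ≃ H¹_𝒟`** (Böckle Thm. 2.2 (a) with Lemma 7.4; Mazur §21): the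
universal property of `𝓡` at the coefficient ring `k[ε]` makes `φ ↦ [cocycle of φ ∘ ρ_𝒟]` a
bijection onto Selmer cocycles modulo coboundaries.
[cite: Bockle2007Presentations, Theorem 2.2] [cite: Mazur1997Deformation, §21] -/
theorem selmerClass_bijective : Function.Bijective 𝓡.selmerClass := by
  haveI : IsNoetherianRing (k[ε]) := (dualCNL 𝒪 k).isNoetherianRing
  haveI : IsAdicComplete (maximalIdeal (k[ε])) (k[ε]) := (dualCNL 𝒪 k).isAdicComplete
  have hsurjπ : Function.Surjective (TrivSqZeroExt.fstHom 𝒪 k k : k[ε] →ₐ[𝒪] k) :=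
    fun a => ⟨TrivSqZeroExt.inl a, rfl⟩
  constructor
  · intro φ₁ φ₂ h
    have h' : 𝒟.selmerSetoid.r (𝓡.selmerCocycle φ₁) (𝓡.selmerCocycle φ₂) := Quotient.exact h
    obtain ⟨X, hX⟩ := h'
    -- the two push-forwards are strictly equivalent, hence `φ₁ = φ₂` by uniqueness
    have hse : IsStrictEquiv ((TrivSqZeroExt.fstHom 𝒪 k k : k[ε] →ₐ[𝒪] k) : k[ε] →+* k)
        ((Matrix.GeneralLinearGroup.map (φ₁ : 𝓡.R →+* k[ε])).comp 𝓡.ρ)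
        ((Matrix.GeneralLinearGroup.map (φ₂ : 𝓡.R →+* k[ε])).comp 𝓡.ρ) :=
      (𝒟.isStrictEquiv_dualNumber_iff ⟨_, 𝓡.map_fst_comp_apply φ₁⟩
        ⟨_, 𝓡.map_fst_comp_apply φ₂⟩).mpr ⟨X, hX⟩
    have huniq := 𝓡.universal (k[ε]) (TrivSqZeroExt.fstHom 𝒪 k k) hsurjπ
      ((Matrix.GeneralLinearGroup.map (φ₂ : 𝓡.R →+* k[ε])).comp 𝓡.ρ)
      (𝓡.isDeformation_map_dualNumber φ₂)
    exact huniq.unique hse (IsStrictEquiv.refl _ _)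
  · intro q
    induction q using Quotient.inductionOn with
    | h c =>
      obtain ⟨c, hc⟩ := c
      -- the lift `(1 + εc)ρ̄` is a deformation of type `𝒟`; universality gives `φ`
      have hdef : 𝒟.IsDeformation (TrivSqZeroExt.fstHom 𝒪 k k) (AdCocycle.lift c).1 :=
        (𝒟.isDeformation_dualNumber_iff _).mpr ⟨(AdCocycle.lift c).2, by
          have : DualLift.cocycle (AdCocycle.lift c) = c := dualLiftEquiv.right_inv c
          rw [show (⟨(AdCocycle.lift c).1, (AdCocycle.lift c).2⟩ : DualLift 𝒟.residual) =
            AdCocycle.lift c from rfl, this]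
          exact hc⟩
      obtain ⟨φ, hφ, -⟩ := 𝓡.universal (k[ε]) (TrivSqZeroExt.fstHom 𝒪 k k) hsurjπ _ hdef
      refine ⟨φ, Quotient.sound ?_⟩
      -- `φ ∘ ρ_𝒟 ∼ (1 + εc)ρ̄`, so the cocycles are cohomologous
      obtain ⟨X, hX⟩ := (𝒟.isStrictEquiv_dualNumber_iff ⟨_, 𝓡.map_fst_comp_apply φ⟩
        (AdCocycle.lift c)).mp hφ
      have h2 : DualLift.cocycle (AdCocycle.lift c) = c := dualLiftEquiv.right_inv c
      refine ⟨X, fun g => ?_⟩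
      have h1 := hX g
      rw [h2] at h1
      exact h1

/-- **`t_{R_𝒟} ≃ H¹_𝒟`** as an equivalence. [cite: Bockle2007Presentations, Theorem 2.2] -/
def tangentSpaceEquivSelmer : (𝓡.R →ₐ[𝒪] k[ε]) ≃ 𝒟.SelmerGroup :=
  Equiv.ofBijective _ 𝓡.selmerClass_bijective

/-- **`#H¹_𝒟 = #Hom_𝒪(R_𝒟, k[ε])`.** [cite: Bockle2007Presentations, Theorem 2.2] -/
theorem natCard_selmerGroup : Nat.card 𝒟.SelmerGroup = Nat.card (𝓡.R →ₐ[𝒪] k[ε]) :=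
  (Nat.card_congr 𝓡.tangentSpaceEquivSelmer).symm

end NearlyOrdinaryDeformationRing

end Literature.NumberTheory.GaloisRepresentations
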